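/-
Copyright: cell pub-balaban-gaps (YM BLITZ Y1, track G1), seat g1-p2 GEN 8 (unit `pub-balaban-gaps-g1-p2`).  Row (D4) NODE O,
JUNCTION J-3 (multi-level), COVARIANT, LEVEL-WEIGHTED: [B9] Cor. 3.5's step for the covariant shift ON THE GENUINE NESTED FAMILY under
PRINT'S LEVEL-DEPENDENT WINDOWS (3.37) — bond `α·L^{−lev(x)}`, divergence `α′·L^{−2lev(x)}` (weight `w(x) = L^{k−lev(x)} = (L^{lev}η)^{−1}`
times the top-scale windows) — paid by the LEVEL-WEIGHTED letters of `D4WalkBlockWeightedLettersMultiLevel`: the instance of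
`D4WalkBlockShiftWeighted` at the fundamental box.  HONEST FRAMING: the flat operator is the lineage's scalar model; the defects are
hypothesis SHAPES; (D4) NOT discharged (instance 0∕1); NOT BetaPertH, NOT continuum, NOT Clay.
-/
import Summits.QuantumFields.BalabanUV.Gaps.D4WalkBlockWeightedLettersMultiLevel

/-!
# `Gaps.D4WalkBlockCovariantWeightedMultiLevel` — Cor. 3.5's step for the covariant Laplacian on [4]'s nested family under print's
# LEVEL-DEPENDENT (3.37) windows (cell pub-balaban-gaps, seat g1-p2 gen 8)

HONEST DEPENDENCY (cell pub-balaban, verbatim): continuum YM on T⁴ ⇐ BetaPertH ∧ nine spine estimates (0/9 proved);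
BetaPertH ⇐ (D1) ∧ (D4) ∧ CAP+tail.

* **`blockWalkExpansion_covShiftW_multiLevelTorus`** — ∃ `δ₁, C, M₀, N₀` (functions of d, ℓ, weight windows) such that for every
  admissible `(k, M_h, R, P, D, a, c, Kc)`, finite fibre, holomorphic defects with the LEVEL-DEPENDENT windows
  `Σ_b‖W^±_μ(u,x)_{ab}‖ ≤ L^{−k}α·w(x) = α·L^{−lev x}`, `Σ_b‖(ΣW⁺+W⁻)(u,x)_{ab}‖ ≤ α′·L^{−2lev x}`, cube row sum `(μ, c_μ)`, `2μ ≤ ε`,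
  `2μ ≤ δ₁ − ε − μ`, margin `c_μ(c_μ·1·(1·((0 + Σ_j covAlphaW·covBW δ₁ L)C))c_μ)c_μ < 1`: `(W ⊗ 1)(1 − V_W(u)(W ⊗ 1))⁻¹` is a block
  walk expansion with the letters `covBW δ₁ L` for `{w², w∇c, wS⁻∇c}` — V86c AT MULTI-LEVEL WITH PRINT'S SCALING; constants uniform in
  `k`, the torus, `{Ω_j}`, the fibre (= `D4WalkBlockShiftWeighted.blockWalkExpansion_covShiftW_of_letters` fed with
  `weightedLetters_multiLevelTorus`, `levW_le_mul_tshift_symm`, `tdist1_cubeML_tshift_symm_unitVec_le_one`).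
WHAT IT IS NOT.  The transporter∕exp backgrounds with level-dependent letters (74's algebra composes); covariant averaging; (D4) instance 0∕1.

References: T. Bałaban, Comm. Math. Phys. **99** (1985) 389–434 [B9], (3.37) p. 396, Thm 3.1 (3.42) p. 397, (3.50)–(3.54) pp. 400–401,
(3.61) p. 402, Cor. 3.5 p. 407; Comm. Math. Phys. **96** (1984) [4], (2.2) p. 224, Prop. 2.2 (2.67) p. 234, Lemma 2.1 (2.61) p. 234.
-/

noncomputable section

namespace Summit.QuantumFields.BalabanUV.Gaps.D4WalkBlockCovariantWeightedMultiLevel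

open Metric
open scoped Matrix
open Literature.MathematicalPhysics.QuantumFieldTheory.Balaban1983to89
open Literature.MathematicalPhysics.QuantumFieldTheory.Balaban1983to89.B4Reflection242 (boxDom)
open Literature.MathematicalPhysics.QuantumFieldTheory.Balaban1983to89.B9SectDWalk (DomBy)
open Literature.MathematicalPhysics.QuantumFieldTheory.Balaban1983to89.B9Thm34Ext (toB6)
open Literature.MathematicalPhysics.QuantumFieldTheory.Balaban1983to89.B9Thm37GlueTorus (torusGeom tdist1)
open Literature.MathematicalPhysics.QuantumFieldTheory.Balaban1983to89.TreeLengthTorus (TPt)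
open Literature.MathematicalPhysics.QuantumFieldTheory.Balaban1983to89.B5TorusCover (UT)
open Literature.MathematicalPhysics.QuantumFieldTheory.Balaban1983to89.B11SectG (RowSum)
open Literature.MathematicalPhysics.QuantumFieldTheory.Balaban1983to89.B6MultiLevelBoxOperator (N0)
open Literature.MathematicalPhysics.QuantumFieldTheory.Balaban1983to89.B6MultiLevelTorusOperator (TDomains gmlT tshift unitVec)
open Literature.MathematicalPhysics.QuantumFieldTheory.Balaban1983to89.B6Ineq243TwoLevelBox (aNext)
open Summit.QuantumFields.BalabanUV.Gaps.D4WalkBlock (blockNorm BlockWalkExpansion)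
open Summit.QuantumFields.BalabanUV.Gaps.D4WalkBlockMultiLevelGeometry (cubeML)
open Summit.QuantumFields.BalabanUV.Gaps.D4WalkBlockShiftAlgebra (covShift)
open Summit.QuantumFields.BalabanUV.Gaps.D4WalkBlockShiftWeighted (covDopW covBW covAlphaW blockWalkExpansion_covShiftW_of_letters)
open Summit.QuantumFields.BalabanUV.Gaps.D4WalkBlockCovariantShiftMultiLevel (tdist1_cubeML_tshift_symm_unitVec_le_one)
open Summit.QuantumFields.BalabanUV.Gaps.D4WalkBlockWeightedLettersMultiLevel (levW levW_pos levW_le_mul_tshift_symm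
  weightedLetters_multiLevelTorus)

variable {d : ℕ}

/-! ## Cor. 3.5's step under print's level-dependent windows on the nested family -/

section Step

variable {dd N' : ℕ} {E : Type*} [NormedAddCommGroup E] [NormedSpace ℂ E]

/-- **[B9] COR. 3.5's STEP FOR THE COVARIANT SHIFT ON THE GENUINE NESTED FAMILY UNDER PRINT'S LEVEL-DEPENDENT (3.37) WINDOWS.**
There are `δ₁, C, M₀ > 0`, `N₀ ≥ 1` (functions of `d, ℓ`, weight windows) such that for every admissible `(k, M_h, R, P, D, a, c, Kc)`,
every finite fibre, every holomorphic defect family with the LEVEL-DEPENDENT windows `Σ_b‖W^±_μ(u,x)_{ab}‖ ≤ L^{−k}α·w(x)` (`= α·L^{−lev x}`)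
and `Σ_b‖(Σ_μW⁺_μ + W⁻_μ)(u,x)_{ab}‖ ≤ L^{−2k}α′·w(x)²` (`= α′·L^{−2 lev x}`), every cube row sum `(μ, c_μ)`, `2μ ≤ ε`, `2μ ≤ δ₁ − ε − μ`, and
the MARGIN `c_μ(c_μ·1·(1·((0 + Σ_j covAlphaW α α′ j·covBW δ₁ L j)C))c_μ)c_μ < 1`: `(W ⊗ 1)(1 − V_W(u)(W ⊗ 1))⁻¹` is a block walk
expansion at `(ε − 2μ, δ₁ − ε − 3μ, c_μC(1·(1−q)⁻¹)c_μ, δ₁ − 2μ)` with the relative letters `covBW δ₁ L` for `{w², w∇c, wS⁻∇c}`, dominating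
distances — constants uniform in `k`, the torus, `{Ω_j}`, the fibre, the weights.
[cite: Balaban1985BackgroundPropagators, Cor. 3.5 p.407, (3.37) p.396, Thm 3.1 (3.42) p.397, (3.61) p.402; Balaban1984PropagatorsII, Prop. 2.2 (2.67) p.234, (2.2) p.224; Balaban1988RG2Cluster, (1.11) p.5] -/
theorem blockWalkExpansion_covShiftW_multiLevelTorus (d ℓ : ℕ) (hℓ : 1 ≤ ℓ) (aminus aplus a2minus a2plus : ℝ)
    (ha : 0 < aminus) (ha2 : 0 < a2minus) :
    ∃ δ₁ C M₀ : ℝ, ∃ N₀ : ℕ, 0 < δ₁ ∧ 0 < C ∧ 0 < M₀ ∧ 0 < N₀ ∧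
      ∀ (k Mh R : ℕ), 3 ≤ Mh → M₀ ≤ ((ℓ : ℝ) + 1) * Mh → 2 * (ℓ + 1) ≤ R → N₀ + 1 ≤ R * ((ℓ + 1) * Mh) →
      ∀ (P : Fin (d + 1) → ℕ) (hP : ∀ μ, 1 ≤ P μ) (hP4 : ∀ μ, 4 ≤ P μ) (D : TDomains d ℓ Mh k P R) (a c : ℕ → ℝ),
        (∀ i, 1 ≤ i → aminus ≤ a i ∧ a i ≤ aplus) → (∀ i, 1 ≤ i → a2minus ≤ c i ∧ c i ≤ a2plus) →
        (∀ i, 1 ≤ i → a (i + 1) = aNext ℓ (a i) (c i)) →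
      ∀ (Kc : Fin (d + 1) → ℕ) [∀ i, NeZero (Kc i)], (∀ i, N0 ℓ Mh k P i = (ℓ + 1) ^ k * Kc i) →
      ∀ (F : Type) [Fintype F] [DecidableEq F] (c₀ : B13.Consts) (Xs : Finset (UT Kc)) (Rb : ℝ)
        (Wp Wm : Fin (d + 1) → E → ↥(boxDom (N0 ℓ Mh k P)) → Matrix F F ℂ) (α α' ε μ cμ : ℝ),
      (∀ ν x a' b, DifferentiableOn ℂ (fun u => Wp ν u x a' b) (ball (0 : E) Rb)) →
      (∀ ν x a' b, DifferentiableOn ℂ (fun u => Wm ν u x a' b) (ball (0 : E) Rb)) →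
      0 ≤ α → 0 ≤ α' →
      (∀ ν, ∀ u ∈ ball (0 : E) Rb, ∀ x a', ∑ b, ‖Wp ν u x a' b‖ ≤ (((ℓ : ℝ) + 1) ^ k)⁻¹ * α * levW D x) →
      (∀ ν, ∀ u ∈ ball (0 : E) Rb, ∀ x a', ∑ b, ‖Wm ν u x a' b‖ ≤ (((ℓ : ℝ) + 1) ^ k)⁻¹ * α * levW D x) →
      (∀ u ∈ ball (0 : E) Rb, ∀ x a', ∑ b, ‖(∑ ν, (Wp ν u x + Wm ν u x)) a' b‖ ≤ ((((ℓ : ℝ) + 1) ^ k)⁻¹) ^ 2 * α' * levW D x ^ 2) →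
      0 ≤ μ → 2 * μ ≤ ε → 2 * μ ≤ δ₁ - ε - μ → 0 ≤ cμ →
      RowSum (toB6 (torusGeom Kc 0 0 0) 0 True) μ cμ →
      cμ * (cμ * 1 * (1 * ((0 + ∑ j : Unit ⊕ (Fin (d + 1) ⊕ Fin (d + 1)), covAlphaW α α' j * covBW δ₁ ((ℓ : ℝ) + 1) j) * C)) *
        cμ) * cμ < 1 →
      ∃ (W : Type) (T : W → (TPt dd N' → ℂ) → E → Matrix (↥(boxDom (N0 ℓ Mh k P)) × F) (↥(boxDom (N0 ℓ Mh k P)) × F) ℂ)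
        (SX' : Set W) (A' : W → ℝ) (D' : W → UT Kc → UT Kc → ℝ),
        BlockWalkExpansion c₀ (fun q : ↥(boxDom (N0 ℓ Mh k P)) × F => cubeML ℓ k Kc q.1.1)
          (fun q : ↥(boxDom (N0 ℓ Mh k P)) × F => cubeML ℓ k Kc q.1.1)
          (fun (_ : TPt dd N' → ℂ) u =>
            Matrix.blockDiagonal (fun _ : F =>
                ((((ℓ : ℂ) + 1) ^ (2 * k))⁻¹ : ℂ) • (gmlT (N0 ℓ Mh k P) ℓ k D.lev a).map ((↑) : ℝ → ℂ)) *
              (1 - covShift ↥(boxDom (N0 ℓ Mh k P)) F (fun ν => tshift (N0 ℓ Mh k P) (unitVec ν))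
                  ((((ℓ : ℝ) + 1) ^ k)⁻¹) Wp Wm u *
                Matrix.blockDiagonal (fun _ : F =>
                  ((((ℓ : ℂ) + 1) ^ (2 * k))⁻¹ : ℂ) • (gmlT (N0 ℓ Mh k P) ℓ k D.lev a).map ((↑) : ℝ → ℂ)))⁻¹)
          Xs Rb (ε - 2 * μ) (δ₁ - ε - μ - 2 * μ)
          (cμ * C * (1 * (1 - cμ * (cμ * 1 * (1 * ((0 + ∑ j : Unit ⊕ (Fin (d + 1) ⊕ Fin (d + 1)),
            covAlphaW α α' j * covBW δ₁ ((ℓ : ℝ) + 1) j) * C)) * cμ) * cμ)⁻¹) * cμ)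
          T SX' A' D' (δ₁ - 2 * μ) ∧
        (∀ (j : Unit ⊕ (Fin (d + 1) ⊕ Fin (d + 1))) ω (σ : TPt dd N' → ℂ), (∀ i, ‖σ i‖ ≤ Real.exp c₀.κ₁) →
          ∀ u ∈ ball (0 : E) Rb, ∀ Y Y',
          blockNorm (fun q : ↥(boxDom (N0 ℓ Mh k P)) × F => cubeML ℓ k Kc q.1.1)
              (fun q : ↥(boxDom (N0 ℓ Mh k P)) × F => cubeML ℓ k Kc q.1.1)
              (covDopW ↥(boxDom (N0 ℓ Mh k P)) F (fun ν => tshift (N0 ℓ Mh k P) (unitVec ν)) ((((ℓ : ℝ) + 1) ^ k)⁻¹) (levW D) j *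
                T ω σ u) Y Y' ≤
            covBW (ι := Fin (d + 1)) δ₁ ((ℓ : ℝ) + 1) j * (A' ω * Real.exp (-((δ₁ - 2 * μ) * D' ω Y Y')))) ∧
        ∀ ω, DomBy (toB6 (torusGeom Kc 0 0 0) 0 True) (D' ω) := by
  obtain ⟨δ₁, C, M₀, N₀, hδ₁, hC, hM₀, hN₀, hlet⟩ := weightedLetters_multiLevelTorus d ℓ hℓ aminus aplus a2minus a2plus ha ha2
  refine ⟨δ₁, C, M₀, N₀, hδ₁, hC, hM₀, hN₀, ?_⟩
  intro k Mh R hMh hM hR hRM P hP hP4 D a c haw hcw hac Kc _ hKc F _ _ c₀ Xs Rb Wp Wm α α' ε μ cμ hWph hWmh hα hα' hWp hWm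
    hdiv hμ hμε hμκ hcμ hrow hq
  have hl := hlet k Mh R hMh hM hR hRM P hP hP4 D a c haw hcw hac Kc hKc F
  have hMh1 : 1 ≤ Mh := le_trans (by norm_num) hMh
  have hR1 : 1 ≤ R := le_trans (by omega) hR
  have hη : (0 : ℝ) < (((ℓ : ℝ) + 1) ^ k)⁻¹ := by positivity
  have hL0 : (0 : ℝ) ≤ (ℓ : ℝ) + 1 := by positivity
  have hsh : ∀ ν (x : ↥(boxDom (N0 ℓ Mh k P))), tdist1 Kc ((fun x : ↥(boxDom (N0 ℓ Mh k P)) => cubeML ℓ k Kc x.1)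
      ((tshift (N0 ℓ Mh k P) (unitVec ν)).symm x)) ((fun x : ↥(boxDom (N0 ℓ Mh k P)) => cubeML ℓ k Kc x.1) x) ≤ 1 :=
    fun ν x => tdist1_cubeML_tshift_symm_unitVec_le_one hKc ν x
  have hwr : ∀ ν (x : ↥(boxDom (N0 ℓ Mh k P))), levW D x ≤ ((ℓ : ℝ) + 1) * levW D ((tshift (N0 ℓ Mh k P) (unitVec ν)).symm x) :=
    fun ν x => levW_le_mul_tshift_symm (D := D) hR1 hMh1 ν x
  exact blockWalkExpansion_covShiftW_of_letters (X := ↥(boxDom (N0 ℓ Mh k P))) (F := F) (E := E) (dd := dd) (N' := N')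
    (sh := fun ν => tshift (N0 ℓ Mh k P) (unitVec ν)) (η := (((ℓ : ℝ) + 1) ^ k)⁻¹) (w := levW D)
    (fun x : ↥(boxDom (N0 ℓ Mh k P)) => cubeML ℓ k Kc x.1) hη (fun x => levW_pos (D := D) x) hL0 hsh hwr _ hC.le hδ₁.le
    (fun Y Y' => (hl Y Y').1) (fun Y Y' => (hl Y Y').2.1) (fun ν Y Y' => (hl Y Y').2.2 ν) c₀ Xs Rb Wp Wm α α' ε μ cμ hWph hWmh hα hα' hWp hWm hdiv hμ hμε
    hμκ hcμ hrow hq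

end Step

end Summit.QuantumFields.BalabanUV.Gaps.D4WalkBlockCovariantWeightedMultiLevel

end
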